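import Literature.Geometry.Riemannian.RicciFlowScalarMaximumPrinciple
import Literature.Geometry.Lorentzian.AFLinearUniqueness
import Mathlib.Analysis.SpecialFunctions.Arsinh
import HarnessLib

/-!
# Sup bound, continuous dependence and uniqueness for linear heat-type equations
# `∂_s w = Δ_{g(s)} w − Q w` on a closed manifold (Topping 2006, Thm. 3.1.1 applied)

The well-posedness half of the linear parabolic Cauchy problem on which Perelman's no local
collapsing theorem now rests (`perelman_noLocalCollapsing_of_linearHeat`,
`PerelmanNoncollapsingLinearHeat.lean`, hypothesis `hLP`: existence of a smooth solution of
`∂_s w = Δ_{h(s)} w − Q w`, `w(0) = w₀`). For a family of Riemannian metrics `g(s)`, `s ∈ [0, T]`,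
`T > 0`, on a closed manifold (no regularity of `g` in `s` is needed), a potential `Q` with
`|Q| ≤ K` on `M × [0, T]`, and `w`, `C^∞` on `M × [0, T]`, solving `∂_s w = Δ_{g(s)} w − Q w`
(one-sided time derivatives within `[0, T]`), we prove from the weak maximum principle
(Topping 2006, Thm. 3.1.1, `weakMaximumPrinciple`, with the `C¹` comparison nonlinearity
`F(r) = K√(r² + δ²) ≥ K|r|` and the explicit solutions `δ sinh(Ks + arsinh(A/δ))` of
`φ' = F(φ)`, `δ ↓ 0`):

* `linearHeat_le_mul_exp` — **sup bound**: `w(·, 0) ≤ A`, `0 ≤ A` ⟹ `w(s, x) ≤ A e^{Ks}`;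
* `linearHeat_abs_le_mul_exp` — `|w(·, 0)| ≤ A` ⟹ `|w(s, x)| ≤ A e^{Ks}` (apply the bound to
  `w` and to `−w`, which solves the same linear equation, `laplaceBeltrami_neg`);
* `linearHeat_abs_sub_le_mul_exp` — **continuous dependence on the initial datum** in the sup
  norm for two solutions (`laplaceBeltrami_sub`, from `dalembertian_sub`);
* `linearHeat_unique` — **uniqueness**: two smooth solutions with the same initial datum coincide
  on `M × [0, T]` (the bound `K` is produced from the joint continuity of `Q`).

Everything is proved; no definition and no named fact is introduced.

## References

* P. Topping, *Lectures on the Ricci flow*, LMS Lecture Note Series 325, CUP 2006, §3.1,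
  Thm. 3.1.1 and Cor. 3.1.2 (p. 35) (weak maximum/minimum principle for
  `∂u/∂t ≤ Δ_{g(t)} u + ⟨X, ∇u⟩ + F(u, t)` on closed manifolds). [Topping2006]
* B. O'Neill, *Semi-Riemannian geometry*, Academic Press 1983, Ch. 3, Def. 3.50 ff. (linearity of
  the Laplacian, `dalembertian_sub`). [ONeill1983]
-/

noncomputable section

open Set Filter Function TopologicalSpace
open scoped Manifold ContDiff Topology

namespace Literature.Geometry.Riemannian

open Lorentzian Lorentzian.PseudoRiemannianMetric

variable {E : Type*} [NormedAddCommGroup E] [NormedSpace ℝ E] [FiniteDimensional ℝ E]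
  [CompleteSpace E] {H : Type*} [TopologicalSpace H] {I : ModelWithCorners ℝ E H} [I.Boundaryless]
  {M : Type*} [TopologicalSpace M] [ChartedSpace H M] [IsManifold I ∞ M] [CompactSpace M]
  {g : ℝ → PseudoRiemannianMetric I ∞ E (TangentSpace I : M → Type _)} {T K : ℝ}
  {Q : ℝ → M → ℝ}

omit [CompactSpace M] in
/-- **`Δ_g (f₁ − f₂) = Δ_g f₁ − Δ_g f₂`** for `C²` functions (`dalembertian_sub` for the
Levi-Civita instance of `g`). [cite: ONeill1983, Ch. 3, Def. 3.50 ff.] -/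
theorem _root_.Literature.Geometry.Lorentzian.PseudoRiemannianMetric.laplaceBeltrami_sub
    (g₀ : PseudoRiemannianMetric I ∞ E (TangentSpace I : M → Type _)) {f₁ f₂ : M → ℝ} {p : M}
    (hf₁ : ContMDiffAt I 𝓘(ℝ, ℝ) 2 f₁ p) (hf₂ : ContMDiffAt I 𝓘(ℝ, ℝ) 2 f₂ p) :
    g₀.laplaceBeltrami (f₁ - f₂) p = g₀.laplaceBeltrami f₁ p - g₀.laplaceBeltrami f₂ p := by
  haveI := g₀.hasLeviCivita
  simp only [laplaceBeltrami_eq_dalembertian]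
  exact dalembertian_sub g₀ hf₁ hf₂

/-- **Sup bound for `∂_s w = Δ_{g(s)} w − Q w` on a closed manifold** (Topping 2006, Thm. 3.1.1
applied with `X = 0`, `F(r) = K√(r² + δ²)`): if `g(s)` is Riemannian for `s ∈ [0, T]`, `T > 0`,
`|Q| ≤ K` on `M × [0, T]`, `w` is `C^∞` on `M × [0, T]` and solves the equation (time derivative
within `[0, T]`), and `w(·, 0) ≤ A` with `0 ≤ A`, then `w(s, x) ≤ A e^{Ks}` on `M × [0, T]`. Proof:
`∂_s w = Δw − Qw ≤ Δw + K√(w² + δ²)`, the comparison solution of `φ' = K√(φ² + δ²)`, `φ(0) = A` is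
`φ_δ(s) = δ sinh(Ks + arsinh(A/δ)) = √(δ² + A²) sinh(Ks) + A cosh(Ks)`, and `δ ↓ 0`.
[cite: Topping2006, Thm. 3.1.1 (p. 35)] -/
theorem linearHeat_le_mul_exp (hT : 0 < T) (hgR : ∀ s ∈ Icc 0 T, (g s).IsRiemannian)
    (hK : 0 ≤ K) (hQ : ∀ s ∈ Icc 0 T, ∀ x, |Q s x| ≤ K) {w : ℝ → M → ℝ}
    (hw : ContMDiffOn (I.prod 𝓘(ℝ, ℝ)) 𝓘(ℝ, ℝ) ∞ (fun p : M × ℝ ↦ w p.2 p.1) (univ ×ˢ Icc 0 T))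
    (hweq : ∀ s ∈ Icc 0 T, ∀ x : M, HasDerivWithinAt (fun r ↦ w r x)
      ((g s).laplaceBeltrami (w s) x - Q s x * w s x) (Icc 0 T) s)
    {A : ℝ} (hA : 0 ≤ A) (hw0 : ∀ x, w 0 x ≤ A) {s : ℝ} (hs : s ∈ Icc 0 T) (x : M) :
    w s x ≤ A * Real.exp (K * s) := by
  have hU : UniqueDiffOn ℝ (Icc (0 : ℝ) T) := uniqueDiffOn_Icc hT
  -- the bound for every `δ > 0`
  have hδ : ∀ δ : ℝ, 0 < δ →
      w s x ≤ Real.sqrt (δ ^ 2 + A ^ 2) * Real.sinh (K * s) + A * Real.cosh (K * s) := by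
    intro δ hδ0
    set c : ℝ := Real.arsinh (A / δ) with hc
    set φ : ℝ → ℝ := fun r ↦ δ * Real.sinh (K * r + c) with hφ
    set F : ℝ → ℝ → ℝ := fun r _ ↦ K * Real.sqrt (r ^ 2 + δ ^ 2) with hF
    have hsq : ∀ r : ℝ, 0 < r ^ 2 + δ ^ 2 := fun r ↦ by positivity
    have hFs : ContDiffOn ℝ 1 (uncurry F) (univ ×ˢ Icc 0 T) := by
      have h1 : ContDiff ℝ 1 fun p : ℝ × ℝ ↦ K * Real.sqrt (p.1 ^ 2 + δ ^ 2) :=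
        contDiff_const.mul ((contDiff_fst.pow 2).add contDiff_const |>.sqrt fun p ↦ (hsq p.1).ne')
      exact h1.contDiffOn
    have hφd : ∀ r ∈ Icc 0 T, HasDerivWithinAt φ (F (φ r) r) (Icc 0 T) r := by
      intro r _
      have h1 : HasDerivAt (fun r ↦ K * r + c) K r := by
        simpa using ((hasDerivAt_id r).const_mul K).add_const c
      have h2 : HasDerivAt φ (δ * (Real.cosh (K * r + c) * K)) r :=
        ((Real.hasDerivAt_sinh _).comp r h1).const_mul δ
      refine h2.hasDerivWithinAt.congr_deriv ?_
      have hcosh : Real.cosh (K * r + c) = Real.sqrt (Real.sinh (K * r + c) ^ 2 + 1) := by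
        rw [← Real.cosh_sq, Real.sqrt_sq (Real.cosh_pos _).le]
      simp only [hF, hφ]
      rw [show (δ * Real.sinh (K * r + c)) ^ 2 + δ ^ 2 = δ ^ 2 * (Real.sinh (K * r + c) ^ 2 + 1) by
        ring, Real.sqrt_mul (sq_nonneg δ), Real.sqrt_sq hδ0.le, hcosh]
      ring
    have hφ0 : φ 0 = A := by
      simp only [hφ, hc, mul_zero, zero_add, Real.sinh_arsinh]
      field_simp
    -- the differential inequality `∂_s w ≤ Δw + ⟨0, ∇w⟩ + F(w)`
    have hineq : ∀ r ∈ Icc 0 T, ∀ y : M,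
        derivWithin (fun r' ↦ w r' y) (Icc 0 T) r ≤ (g r).laplaceBeltrami (w r) y
          + mvfderiv I (w r) y ((fun _ _ ↦ (0 : TangentSpace I y)) r y) + F (w r y) r := by
      intro r hr y
      rw [(hweq r hr y).derivWithin (hU r hr), map_zero, add_zero]
      simp only [hF]
      have hb := hQ r hr y
      have habs : |Q r y * w r y| ≤ K * Real.sqrt (w r y ^ 2 + δ ^ 2) := by
        rw [abs_mul]
        refine mul_le_mul hb ?_ (abs_nonneg _) hK
        rw [← Real.sqrt_sq_eq_abs]
        exact Real.sqrt_le_sqrt (by nlinarith)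
      linarith [(abs_le.1 habs).1, neg_abs_le (Q r y * w r y), le_abs_self (Q r y * w r y)]
    have hmax := weakMaximumPrinciple (I := I) (M := M) hT hgR (fun _ y ↦ (0 : TangentSpace I y))
      hFs hw hineq hφd hφ0 hw0 s hs x
    -- `φ_δ(s) = √(δ² + A²) sinh(Ks) + A cosh(Ks)`
    have hφs : φ s = Real.sqrt (δ ^ 2 + A ^ 2) * Real.sinh (K * s) + A * Real.cosh (K * s) := by
      simp only [hφ, hc, Real.sinh_add, Real.sinh_arsinh, Real.cosh_arsinh]
      have hsq' : Real.sqrt (1 + (A / δ) ^ 2) = Real.sqrt (δ ^ 2 + A ^ 2) / δ := by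
        rw [show (1 + (A / δ) ^ 2) = (δ ^ 2 + A ^ 2) / δ ^ 2 by field_simp, Real.sqrt_div (by positivity),
          Real.sqrt_sq hδ0.le]
      rw [hsq']
      field_simp
    rw [hφs] at hmax
    exact hmax
  -- `δ ↓ 0`
  have hlim : Tendsto (fun δ : ℝ ↦ Real.sqrt (δ ^ 2 + A ^ 2) * Real.sinh (K * s) + A * Real.cosh (K * s))
      (𝓝[>] 0) (𝓝 (Real.sqrt (0 ^ 2 + A ^ 2) * Real.sinh (K * s) + A * Real.cosh (K * s))) := by
    refine ((Continuous.tendsto ?_ 0).mono_left nhdsWithin_le_nhds)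
    fun_prop
  have hval : Real.sqrt (0 ^ 2 + A ^ 2) * Real.sinh (K * s) + A * Real.cosh (K * s) =
      A * Real.exp (K * s) := by
    rw [zero_pow two_ne_zero, zero_add, Real.sqrt_sq hA, ← Real.cosh_add_sinh]
    ring
  rw [← hval]
  exact ge_of_tendsto hlim (eventually_nhdsWithin_of_forall fun δ hδ0 ↦ hδ δ hδ0)

/-- **Two-sided sup bound**: under the hypotheses of `linearHeat_le_mul_exp`, `|w(·, 0)| ≤ A`
implies `|w(s, x)| ≤ A e^{Ks}` on `M × [0, T]` (the bound for `w` and for `−w`, which solves the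
same linear equation, `laplaceBeltrami_neg`). [cite: Topping2006, Thm. 3.1.1 and Cor. 3.1.2 (p. 35)] -/
theorem linearHeat_abs_le_mul_exp (hT : 0 < T) (hgR : ∀ s ∈ Icc 0 T, (g s).IsRiemannian)
    (hK : 0 ≤ K) (hQ : ∀ s ∈ Icc 0 T, ∀ x, |Q s x| ≤ K) {w : ℝ → M → ℝ}
    (hw : ContMDiffOn (I.prod 𝓘(ℝ, ℝ)) 𝓘(ℝ, ℝ) ∞ (fun p : M × ℝ ↦ w p.2 p.1) (univ ×ˢ Icc 0 T))
    (hweq : ∀ s ∈ Icc 0 T, ∀ x : M, HasDerivWithinAt (fun r ↦ w r x)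
      ((g s).laplaceBeltrami (w s) x - Q s x * w s x) (Icc 0 T) s)
    {A : ℝ} (hw0 : ∀ x, |w 0 x| ≤ A) {s : ℝ} (hs : s ∈ Icc 0 T) (x : M) :
    |w s x| ≤ A * Real.exp (K * s) := by
  have hA : 0 ≤ A := (abs_nonneg _).trans (hw0 x)
  refine abs_le.2 ⟨?_, linearHeat_le_mul_exp hT hgR hK hQ hw hweq hA
    (fun y ↦ (le_abs_self _).trans (hw0 y)) hs x⟩
  -- the bound for `-w`
  have hw' : ContMDiffOn (I.prod 𝓘(ℝ, ℝ)) 𝓘(ℝ, ℝ) ∞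
      (fun p : M × ℝ ↦ (fun r y ↦ -w r y) p.2 p.1) (univ ×ˢ Icc 0 T) := hw.neg
  have hweq' : ∀ r ∈ Icc 0 T, ∀ y : M, HasDerivWithinAt (fun r' ↦ (fun r y ↦ -w r y) r' y)
      ((g r).laplaceBeltrami ((fun r y ↦ -w r y) r) y - Q r y * (fun r y ↦ -w r y) r y)
      (Icc 0 T) r := by
    intro r hr y
    have e : (g r).laplaceBeltrami (fun y ↦ -w r y) y = -(g r).laplaceBeltrami (w r) y :=
      (g r).laplaceBeltrami_neg (w r) y
    simp only [e]
    exact (hweq r hr y).neg.congr_deriv (by ring)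
  have key := linearHeat_le_mul_exp hT hgR hK hQ hw' hweq' hA
    (fun y ↦ by linarith [(abs_le.1 (hw0 y)).1]) hs x
  change -w s x ≤ A * Real.exp (K * s) at key
  linarith

/-- **Continuous dependence on the initial datum in the sup norm** (Topping 2006, Thm. 3.1.1
applied to the difference): two solutions `w₁, w₂`, `C^∞` on `M × [0, T]`, of
`∂_s w = Δ_{g(s)} w − Q w` (`|Q| ≤ K`) with `|w₁(·, 0) − w₂(·, 0)| ≤ A` satisfy
`|w₁(s, x) − w₂(s, x)| ≤ A e^{Ks}` on `M × [0, T]` (the difference solves the same linear equation,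
`laplaceBeltrami_sub`). [cite: Topping2006, Thm. 3.1.1 (p. 35)] -/
theorem linearHeat_abs_sub_le_mul_exp (hT : 0 < T) (hgR : ∀ s ∈ Icc 0 T, (g s).IsRiemannian)
    (hK : 0 ≤ K) (hQ : ∀ s ∈ Icc 0 T, ∀ x, |Q s x| ≤ K) {w₁ w₂ : ℝ → M → ℝ}
    (hw₁ : ContMDiffOn (I.prod 𝓘(ℝ, ℝ)) 𝓘(ℝ, ℝ) ∞ (fun p : M × ℝ ↦ w₁ p.2 p.1) (univ ×ˢ Icc 0 T))
    (hw₁eq : ∀ s ∈ Icc 0 T, ∀ x : M, HasDerivWithinAt (fun r ↦ w₁ r x)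
      ((g s).laplaceBeltrami (w₁ s) x - Q s x * w₁ s x) (Icc 0 T) s)
    (hw₂ : ContMDiffOn (I.prod 𝓘(ℝ, ℝ)) 𝓘(ℝ, ℝ) ∞ (fun p : M × ℝ ↦ w₂ p.2 p.1) (univ ×ˢ Icc 0 T))
    (hw₂eq : ∀ s ∈ Icc 0 T, ∀ x : M, HasDerivWithinAt (fun r ↦ w₂ r x)
      ((g s).laplaceBeltrami (w₂ s) x - Q s x * w₂ s x) (Icc 0 T) s)
    {A : ℝ} (h0 : ∀ x, |w₁ 0 x - w₂ 0 x| ≤ A) {s : ℝ} (hs : s ∈ Icc 0 T) (x : M) :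
    |w₁ s x - w₂ s x| ≤ A * Real.exp (K * s) := by
  have h2 : (2 : ℕ∞ω) ≤ ∞ := WithTop.coe_le_coe.mpr le_top
  have hw : ContMDiffOn (I.prod 𝓘(ℝ, ℝ)) 𝓘(ℝ, ℝ) ∞
      (fun p : M × ℝ ↦ (fun r y ↦ w₁ r y - w₂ r y) p.2 p.1) (univ ×ˢ Icc 0 T) := hw₁.sub hw₂
  have hweq : ∀ r ∈ Icc 0 T, ∀ y : M, HasDerivWithinAt (fun r' ↦ (fun r y ↦ w₁ r y - w₂ r y) r' y)
      ((g r).laplaceBeltrami ((fun r y ↦ w₁ r y - w₂ r y) r) y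
        - Q r y * (fun r y ↦ w₁ r y - w₂ r y) r y) (Icc 0 T) r := by
    intro r hr y
    have hc₁ : ContMDiffAt I 𝓘(ℝ, ℝ) 2 (w₁ r) y := ((contMDiff_slice hw₁ hr).of_le h2).contMDiffAt
    have hc₂ : ContMDiffAt I 𝓘(ℝ, ℝ) 2 (w₂ r) y := ((contMDiff_slice hw₂ hr).of_le h2).contMDiffAt
    have e : (g r).laplaceBeltrami (fun y ↦ w₁ r y - w₂ r y) y =
        (g r).laplaceBeltrami (w₁ r) y - (g r).laplaceBeltrami (w₂ r) y :=
      (g r).laplaceBeltrami_sub hc₁ hc₂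
    simp only [e]
    exact ((hw₁eq r hr y).sub (hw₂eq r hr y)).congr_deriv (by ring)
  have key := linearHeat_abs_le_mul_exp hT hgR hK hQ hw hweq h0 hs x
  simpa using key

/-- **Uniqueness for the linear heat-type Cauchy problem on a closed manifold** (Topping 2006,
Thm. 3.1.1 applied): if `g(s)` is Riemannian for `s ∈ [0, T]`, `T > 0`, `Q` is jointly continuous
on `M × [0, T]`, and `w₁, w₂` are `C^∞` on `M × [0, T]`, solve `∂_s w = Δ_{g(s)} w − Q w` (time
derivatives within `[0, T]`) and agree at `s = 0`, then `w₁ = w₂` on `M × [0, T]`.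
[cite: Topping2006, Thm. 3.1.1 (p. 35)] -/
theorem linearHeat_unique (hT : 0 < T) (hgR : ∀ s ∈ Icc 0 T, (g s).IsRiemannian)
    (hQc : ContinuousOn (fun p : M × ℝ ↦ Q p.2 p.1) (univ ×ˢ Icc 0 T)) {w₁ w₂ : ℝ → M → ℝ}
    (hw₁ : ContMDiffOn (I.prod 𝓘(ℝ, ℝ)) 𝓘(ℝ, ℝ) ∞ (fun p : M × ℝ ↦ w₁ p.2 p.1) (univ ×ˢ Icc 0 T))
    (hw₁eq : ∀ s ∈ Icc 0 T, ∀ x : M, HasDerivWithinAt (fun r ↦ w₁ r x)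
      ((g s).laplaceBeltrami (w₁ s) x - Q s x * w₁ s x) (Icc 0 T) s)
    (hw₂ : ContMDiffOn (I.prod 𝓘(ℝ, ℝ)) 𝓘(ℝ, ℝ) ∞ (fun p : M × ℝ ↦ w₂ p.2 p.1) (univ ×ˢ Icc 0 T))
    (hw₂eq : ∀ s ∈ Icc 0 T, ∀ x : M, HasDerivWithinAt (fun r ↦ w₂ r x)
      ((g s).laplaceBeltrami (w₂ s) x - Q s x * w₂ s x) (Icc 0 T) s)
    (h0 : w₁ 0 = w₂ 0) {s : ℝ} (hs : s ∈ Icc 0 T) (x : M) : w₁ s x = w₂ s x := by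
  -- a bound `K ≥ |Q|` on the compact `M × [0, T]`
  obtain ⟨C, hC⟩ := (isCompact_univ.prod (isCompact_Icc (a := (0 : ℝ)) (b := T))).exists_bound_of_continuousOn hQc
  have hQ : ∀ r ∈ Icc 0 T, ∀ y : M, |Q r y| ≤ max C 0 := fun r hr y ↦
    le_trans (by simpa using hC (y, r) ⟨mem_univ _, hr⟩) (le_max_left _ _)
  have key := linearHeat_abs_sub_le_mul_exp hT hgR (le_max_right C 0) hQ hw₁ hw₁eq hw₂ hw₂eq
    (A := 0) (fun y ↦ by simp [h0]) hs x
  rw [zero_mul, abs_nonpos_iff, sub_eq_zero] at key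
  exact key

end Literature.Geometry.Riemannian

end
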